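import Summits.QuantumFields.BalabanUV.T4Continuum.Support.NE7SliceLetterGaugeObstruction
import Summits.QuantumFields.BalabanUV.T4Continuum.Support.NE7CovariantByParts
import Summits.QuantumFields.BalabanUV.T4Continuum.Support.AveragingDeficitKDatum
import HarnessLib

/-!
# NE7ConstantFluxBackground — THE CONSTANT ABELIAN FLUX BACKGROUND ON THE TORUS: `W(y, κ₁) = e^{y_{κ₀}·B}`, all other links `1` (`B ∈ 𝔲(N)`, `e^{P·B} = 1`) is UNITARY,
# `P`-PERIODIC, SMALL-FIELD with radius `max ‖e^{±B} − 1‖`, has ZERO covariant plaquette gradient and ZERO flux gradient, and is CRITICAL ON EVERY PERIODIC DIRECTION (covariantly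
# constant flux); hence (F128) at every such background with `ζ − Ad_{e^{B}}ζ ≠ 0` for one skew `ζ` the curved slice-solver letter (L2) of F123d is UNSATISFIABLE (file 59)

Cell `pub-balaban`, rung (B)+1 sub-cell t4, lineage `b2b-balaban-t4-ne7-p1` (CRUX PROVER NE7 #1 = OWNER of row NE7), generation 80; memo
`t4/b2b-balaban-t4-ne7-p1-g80/SLICE-LETTER-OBSTRUCTION.md` §2.  File F129, over F128 `NE7SliceLetterGaugeObstruction.sliceLetter_false_of_critical`, F61
`NE7CovariantByParts.abs_sum_nReTr_curlAt_mul_le_W` (the by-parts letter: the first variation against a plaquette field costs its covariant adjacent differences — ZERO for a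
covariantly constant flux), `B7Prop1Explicit.mlog_units_conj`, `AveragingDeficitCovGrad.hol_plaqWord_units`.
WHY.  F128 refutes the curved (L2) letter at any globally critical background of the class with a non-commuting plaquette; THIS file exhibits such backgrounds INSIDE THE DATA OF
F123d: the lattice constant-curvature abelian connections.  With `W(y,κ₁) = e^{y_{κ₀}B}` and `W = 1` on all other bonds, every plaquette variable is `e^{B}` (plane `(κ₀,κ₁)`), `e^{−B}`
(plane `(κ₁,κ₀)`) or `1`, INDEPENDENT of the site and COMMUTING with every link; so the covariant adjacent differences of the plaquette field vanish, the by-parts letter F61 gives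
`dAction W Y (perWin d P) = 0` for EVERY periodic `Y` (a genuine non-flat critical point of the Wilson action — the discrete Yang–Mills equation `δ_W F = 0` for covariantly constant
`F`), the plaquette-gradient radius `x₁` and the flux-gradient radius `g_W` are `0`, and the small-field radius is `‖e^{±B} − 1‖` — as small as one wishes on a large torus
(`e^{PB} = 1` forces `‖B‖ ≳ 2π∕P` only).  F130 `NE7SliceLetterConstantFluxWitness` supplies concrete `B = diag(2πi∕P, 0, …)`, `ζ = E₁₂ − E₂₁` for `card n ≥ 2`.
WHAT ([folklore]; 0 def, 0 sorry; the background enters through the EQUATIONAL HYPOTHESIS `hW : ∀ y κ, W y κ = if κ = κ₁ then expUnit ((y κ₀ : ℂ) • B) else 1`).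
§1 exponentials of multiples of `B` (products, units, commutation, unitarity); §2 the links and the plaquette variables (`hol_plaqWord_eq`: the three values); §3 class data:
`isUnitaryCfg_constFlux`, `isPeriodicCfg_constFlux`, `smallField_constFlux`, `plaqGrad_constFlux` (`x₁ = 0`), `fluxGrad_constFlux` (`g_W = 0`, needs radius `< 1`); §4
**`dAction_constFlux_eq_zero`** (critical on every periodic direction) and `tanCritical_constFlux`; §5 **`sliceLetter_false_constFlux`** — F123d's `hS`∕`hG` at this `W` ⟹ `False`,
given `LevelSmall d L j a` for the radius and ONE skew `ζ` with `ζ − Ad_{e^{B}}ζ ≠ 0` (witness: the bump at `e_{κ₀}`, off the corner lattice since `L^{j+1} ≥ 2`).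
HONEST FRAMING (page 1): an explicit lattice configuration and elementary matrix algebra; nothing of Bałaban's asserted; a NEGATIVE result about OUR letter (L2) as typed (the END
F123d is vacuous at these admissible backgrounds); the flat (152) untouched; NOT ONE-STEP, NOT NE7; spine 0∕9; finite T⁴ rung (B)+1 — NOT infinite volume, NOT mass gap, NOT
`BetaPertH`, NOT Clay.  Continuum YM on T⁴ ⇐ BetaPertH ∧ nine spine estimates (0/9 proved); BetaPertH ⇐ (D1) ∧ (D4) ∧ CAP+tail; G-an2-4 gates asym, D1 and NE2/3/4.
-/

set_option autoImplicit false

open scoped BigOperators Matrix.Norms.L2Operator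
open NormedSpace Finset

namespace Summit.QuantumFields.BalabanUV.T4Continuum.NE7ConstantFluxBackground

open Literature.MathematicalPhysics.QuantumFieldTheory.Balaban1983to89
open B7Prop1Explicit B7Prop2Explicit MatrixLog UnitaryModel
open T4AveragingDeficitWall hiding Site Plane Plaq Bond
open T4AveragingDeficitWallBoundary (IsPeriodicCfg periodBox)
open AveragingDeficitPeriodicCounting (IsPeriodicDir)
open AveragingDeficitMultiLevelPrep (LevelSmall)
open MinimalActionLevels (perWin)
open NE3HessForm (hess dAction)
open NE3TangentCovariantTower (dirIter)
open AveragingDeficitCovGrad (hol_plaqWord_units)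
open AveragingDeficitTransport (mem_U1_of_unitary)
open AveragingDeficitNearIdentity (Ad_one)
open NE7CovariantByParts (abs_sum_nReTr_curlAt_mul_le_W)
open NE7SliceLetterGaugeObstruction (sliceLetter_false_of_critical bump_centre bump_skew bump_periodic bump_sparse bump_vanish_corners)

noncomputable section

variable {d : ℕ} {n : Type*} [Fintype n] [DecidableEq n]

/-! ## §1 Exponentials of multiples of one matrix -/

/-- `e^{(a+b)B} = e^{aB}·e^{bB}` as units. [folklore] -/
theorem expUnit_add_smul (B : Matrix n n ℂ) (a b : ℂ) : expUnit ((a + b) • B) = expUnit (a • B) * expUnit (b • B) := by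
  letI : NormedAlgebra ℚ (Matrix n n ℂ) := NormedAlgebra.restrictScalars ℚ ℂ (Matrix n n ℂ)
  apply Units.ext
  have hc : Commute (a • B) (b • B) := ((Commute.refl B).smul_left a).smul_right b
  simp only [Units.val_mul, val_expUnit, add_smul]
  exact exp_add_of_commute hc

/-- Two exponentials of multiples of `B` commute. [folklore] -/
theorem commute_exp_smul (B : Matrix n n ℂ) (a b : ℂ) : Commute (exp (a • B)) (exp (b • B)) := by
  letI : NormedAlgebra ℚ (Matrix n n ℂ) := NormedAlgebra.restrictScalars ℚ ℂ (Matrix n n ℂ)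
  exact (((Commute.refl B).smul_left a).smul_right b).exp_left.exp_right

/-- `Ad_u X = X` when `u` commutes with `X`. [folklore] -/
theorem Ad_eq_of_commute {u : (Matrix n n ℂ)ˣ} {X : Matrix n n ℂ} (h : Commute ((u : (Matrix n n ℂ)ˣ) : Matrix n n ℂ) X) : Ad u X = X := by
  unfold Ad
  rw [h.eq, mul_assoc, Units.mul_inv, mul_one]

/-- A real multiple of a skew matrix exponentiates to a unitary unit. [folklore] -/
theorem expUnit_real_smul_mem_unitary {B : Matrix n n ℂ} (hB : B ∈ skewAdjoint (Matrix n n ℂ)) (r : ℝ) :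
    expUnit (((r : ℂ)) • B) ∈ unitaryUnits (Matrix n n ℂ) := by
  letI : NormedAlgebra ℚ (Matrix n n ℂ) := NormedAlgebra.restrictScalars ℚ ℝ (Matrix n n ℂ)
  have hskew : (r : ℂ) • B ∈ skewAdjoint (Matrix n n ℂ) := by
    rw [Complex.coe_smul]
    exact skewAdjoint.smul_mem r hB
  rw [mem_unitaryUnits]
  exact NormedSpace.exp_mem_unitary_of_mem_skewAdjoint hskew

/-! ## §2 The links and the plaquette variables of the constant-flux background -/

section Flux

variable {κ₀ κ₁ : Fin d} {B : Matrix n n ℂ} {W : Site d → Fin d → (Matrix n n ℂ)ˣ}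

/-- Every link is `e^{cB}` for some `c`. [folklore] -/
theorem link_eq_exp (hW : ∀ (y : Site d) (κ : Fin d), W y κ = if κ = κ₁ then expUnit (((y κ₀ : ℤ) : ℂ) • B) else 1) (y : Site d) (κ : Fin d) :
    ∃ c : ℂ, ((W y κ : (Matrix n n ℂ)ˣ) : Matrix n n ℂ) = exp (c • B) := by
  rw [hW y κ]
  split_ifs
  · exact ⟨((y κ₀ : ℤ) : ℂ), rfl⟩
  · exact ⟨0, by simp⟩

/-- **THE PLAQUETTE VARIABLES**: `hol_W(∂p) = e^{B}` in the plane `(κ₀,κ₁)`, `e^{−B}` in the plane `(κ₁,κ₀)`, `1` in every other plane — independently of the site. [folklore] -/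
theorem hol_plaqWord_eq (hκ : κ₀ ≠ κ₁)
    (hW : ∀ (y : Site d) (κ : Fin d), W y κ = if κ = κ₁ then expUnit (((y κ₀ : ℤ) : ℂ) • B) else 1) (z : Site d) (μ ν : Fin d) :
    hol W z (plaqWord μ ν)
      = if μ = κ₀ ∧ ν = κ₁ then expUnit B else if μ = κ₁ ∧ ν = κ₀ then expUnit (-B) else 1 := by
  rw [hol_plaqWord_units]
  -- coordinates of the shifted corners in direction `κ₀`
  have hsame : ∀ {ν' : Fin d}, ν' ≠ κ₀ → (z + e ν') κ₀ = z κ₀ := fun {ν'} h => by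
    simp only [Pi.add_apply, B7Prop1Explicit.e, Pi.single_eq_of_ne h.symm, add_zero]
  have hstep : (z + e κ₀) κ₀ = z κ₀ + 1 := by
    simp only [Pi.add_apply, B7Prop1Explicit.e, Pi.single_eq_same]
  -- the link values
  have hl1 : ∀ (y : Site d) (κ : Fin d), κ = κ₁ → W y κ = expUnit (((y κ₀ : ℤ) : ℂ) • B) := fun y κ h => by rw [hW, if_pos h]
  have hl0 : ∀ (y : Site d) (κ : Fin d), κ ≠ κ₁ → W y κ = 1 := fun y κ h => by rw [hW, if_neg h]
  -- `e^{(c+1)B} = e^{cB}·e^{B}`; conjugating `e^{bB}` by `e^{cB}` does nothing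
  have hsucc : expUnit ((((z κ₀ + 1 : ℤ)) : ℂ) • B) = expUnit (((z κ₀ : ℤ) : ℂ) • B) * expUnit ((1 : ℂ) • B) := by
    rw [show (((z κ₀ + 1 : ℤ)) : ℂ) = ((z κ₀ : ℤ) : ℂ) + 1 by push_cast; ring, expUnit_add_smul]
  have hconj : ∀ b : ℂ, expUnit (((z κ₀ : ℤ) : ℂ) • B) * expUnit (b • B) * (expUnit (((z κ₀ : ℤ) : ℂ) • B))⁻¹ = expUnit (b • B) := fun b => by
    have h : Commute (expUnit (((z κ₀ : ℤ) : ℂ) • B)) (expUnit (b • B)) := Commute.units_of_val (commute_exp_smul B _ b)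
    rw [h.eq, mul_inv_cancel_right]
  have hconj' : ∀ b : ℂ, expUnit (((z κ₀ : ℤ) : ℂ) • B) * (expUnit (b • B))⁻¹ * (expUnit (((z κ₀ : ℤ) : ℂ) • B))⁻¹ = expUnit ((-b) • B) := fun b => by
    rw [val_inv_expUnit (b • B), ← neg_smul, hconj]
  have hB1 : expUnit B = expUnit ((1 : ℂ) • B) := by rw [one_smul]
  have hBm1 : expUnit (-B) = expUnit ((-(1 : ℂ)) • B) := by rw [neg_smul, one_smul]
  by_cases hμ : μ = κ₁
  · have hμ0 : μ ≠ κ₀ := fun h0 => hκ (h0.symm.trans hμ)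
    rw [if_neg (show ¬(μ = κ₀ ∧ ν = κ₁) from fun h => hμ0 h.1)]
    by_cases hν : ν = κ₁
    · have hν0 : ν ≠ κ₀ := fun h0 => hκ (h0.symm.trans hν)
      rw [hl1 z μ hμ, hl1 (z + e μ) ν hν, hl1 (z + e ν) μ hμ, hl1 z ν hν, hsame hμ0, hsame hν0,
        if_neg (show ¬(μ = κ₁ ∧ ν = κ₀) from fun h => hν0 h.2), mul_inv_cancel_right, mul_inv_cancel]
    · rw [hl1 z μ hμ, hl0 (z + e μ) ν hν, hl1 (z + e ν) μ hμ, hl0 z ν hν, mul_one, inv_one, mul_one]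
      by_cases hν0 : ν = κ₀
      · rw [if_pos (show μ = κ₁ ∧ ν = κ₀ from ⟨hμ, hν0⟩), hν0, hstep, hsucc, mul_inv_rev, ← mul_assoc, hconj', hBm1]
      · rw [if_neg (show ¬(μ = κ₁ ∧ ν = κ₀) from fun h => hν0 h.2), hsame hν0, mul_inv_cancel]
  · rw [hl0 z μ hμ, hl0 (z + e ν) μ hμ, one_mul, inv_one, mul_one, if_neg (show ¬(μ = κ₁ ∧ ν = κ₀) from fun h => hμ h.1)]
    by_cases hν : ν = κ₁
    · rw [hl1 (z + e μ) ν hν, hl1 z ν hν]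
      by_cases hμ0 : μ = κ₀
      · rw [if_pos (show μ = κ₀ ∧ ν = κ₁ from ⟨hμ0, hν⟩), hμ0, hstep, hsucc, hconj, hB1]
      · rw [if_neg (show ¬(μ = κ₀ ∧ ν = κ₁) from fun h => hμ0 h.1), hsame hμ0, mul_inv_cancel]
    · rw [hl0 (z + e μ) ν hν, hl0 z ν hν, inv_one, mul_one, if_neg (show ¬(μ = κ₀ ∧ ν = κ₁) from fun h => hν h.2)]

/-- Every plaquette variable is `e^{cB}` for some `c ∈ {1, −1, 0}`. [folklore] -/
theorem hol_eq_exp (hκ : κ₀ ≠ κ₁)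
    (hW : ∀ (y : Site d) (κ : Fin d), W y κ = if κ = κ₁ then expUnit (((y κ₀ : ℤ) : ℂ) • B) else 1) (z : Site d) (μ ν : Fin d) :
    ∃ c : ℂ, ((hol W z (plaqWord μ ν) : (Matrix n n ℂ)ˣ) : Matrix n n ℂ) = exp (c • B) := by
  rw [hol_plaqWord_eq hκ hW]
  split_ifs
  · exact ⟨1, by simp⟩
  · exact ⟨-1, by simp⟩
  · exact ⟨0, by simp⟩

/-- Every link commutes with every plaquette variable. [folklore] -/
theorem commute_link_hol (hκ : κ₀ ≠ κ₁)
    (hW : ∀ (y : Site d) (κ : Fin d), W y κ = if κ = κ₁ then expUnit (((y κ₀ : ℤ) : ℂ) • B) else 1) (y : Site d) (κ : Fin d) (z : Site d) (μ ν : Fin d) :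
    Commute ((W y κ : (Matrix n n ℂ)ˣ) : Matrix n n ℂ) ((hol W z (plaqWord μ ν) : (Matrix n n ℂ)ˣ) : Matrix n n ℂ) := by
  obtain ⟨a, ha⟩ := link_eq_exp hW y κ
  obtain ⟨b, hb⟩ := hol_eq_exp hκ hW z μ ν
  rw [ha, hb]
  exact commute_exp_smul B a b

/-- The plaquette variables do not depend on the site. [folklore] -/
theorem hol_site_indep (hκ : κ₀ ≠ κ₁)
    (hW : ∀ (y : Site d) (κ : Fin d), W y κ = if κ = κ₁ then expUnit (((y κ₀ : ℤ) : ℂ) • B) else 1) (z z' : Site d) (μ ν : Fin d) :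
    hol W z (plaqWord μ ν) = hol W z' (plaqWord μ ν) := by
  rw [hol_plaqWord_eq hκ hW, hol_plaqWord_eq hκ hW]

/-! ## §3 Class data: unitary, periodic, small field, zero plaquette and flux gradients -/

/-- The constant-flux background is `U(N)`-valued (for skew `B`). [folklore] -/
theorem isUnitaryCfg_constFlux (hW : ∀ (y : Site d) (κ : Fin d), W y κ = if κ = κ₁ then expUnit (((y κ₀ : ℤ) : ℂ) • B) else 1)
    (hB : B ∈ skewAdjoint (Matrix n n ℂ)) : IsUnitaryCfg W := by
  intro y κ
  rw [hW y κ]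
  split_ifs
  · have h := expUnit_real_smul_mem_unitary hB ((y κ₀ : ℤ) : ℝ)
    simpa only [Complex.ofReal_intCast] using h
  · exact (unitaryUnits (Matrix n n ℂ)).one_mem

/-- The constant-flux background is `P`-periodic when `e^{PB} = 1`. [folklore] -/
theorem isPeriodicCfg_constFlux (hW : ∀ (y : Site d) (κ : Fin d), W y κ = if κ = κ₁ then expUnit (((y κ₀ : ℤ) : ℂ) • B) else 1)
    {P : ℕ} (hBP : expUnit ((P : ℂ) • B) = 1) : IsPeriodicCfg W (P : ℤ) := by
  intro y i κ
  rw [hW, hW y κ]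
  split_ifs with h
  · by_cases hi : i = κ₀
    · subst hi
      have hc : ((y + (P : ℤ) • e i) i : ℤ) = y i + P := by
        simp only [Pi.add_apply, Pi.smul_apply, B7Prop1Explicit.e, Pi.single_eq_same, smul_eq_mul, mul_one]
      rw [hc, show (((y i + (P : ℤ) : ℤ)) : ℂ) = ((y i : ℤ) : ℂ) + (P : ℂ) by push_cast; ring, expUnit_add_smul, hBP, mul_one]
    · have hc : ((y + (P : ℤ) • e i) κ₀ : ℤ) = y κ₀ := by
        simp only [Pi.add_apply, Pi.smul_apply, B7Prop1Explicit.e, Pi.single_eq_of_ne (Ne.symm hi), smul_eq_mul, mul_zero, add_zero]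
      rw [hc]
  · rfl

/-- **SMALL FIELD**: every plaquette variable is within `a` of `1` as soon as `‖e^{B} − 1‖ ≤ a` and `‖e^{−B} − 1‖ ≤ a`. [folklore] -/
theorem smallField_constFlux (hκ : κ₀ ≠ κ₁)
    (hW : ∀ (y : Site d) (κ : Fin d), W y κ = if κ = κ₁ then expUnit (((y κ₀ : ℤ) : ℂ) • B) else 1)
    {a : ℝ} (ha : ‖exp B - 1‖ ≤ a) (ha' : ‖exp (-B) - 1‖ ≤ a) : SmallField W a := by
  intro z μ ν _
  rw [hol_plaqWord_eq hκ hW]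
  split_ifs
  · simpa using ha
  · simpa using ha'
  · have h0 : (0 : ℝ) ≤ a := (norm_nonneg _).trans ha
    simpa using h0

/-- **ZERO COVARIANT PLAQUETTE GRADIENT** (row NE3's class datum `x₁`, F115's `hgrad`, at `x₁ = 0`). [folklore] -/
theorem plaqGrad_constFlux (hκ : κ₀ ≠ κ₁)
    (hW : ∀ (y : Site d) (κ : Fin d), W y κ = if κ = κ₁ then expUnit (((y κ₀ : ℤ) : ℂ) • B) else 1) (p : Site d) (μ κ : Fin d) :
    ‖Ad (W p μ) ((hol W (p + e μ) (plaqWord κ μ) : (Matrix n n ℂ)ˣ) : Matrix n n ℂ) - ((hol W p (plaqWord κ μ) : (Matrix n n ℂ)ˣ) : Matrix n n ℂ)‖ ≤ 0 := by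
  rw [hol_site_indep hκ hW (p + e μ) p, Ad_eq_of_commute (commute_link_hol hκ hW p μ p κ μ), sub_self, norm_zero]

/-- **ZERO FLUX GRADIENT** (F123d's `hgW` at `g_W = 0`), for small-field radius `< 1` (so that the flux is the conjugation-covariant logarithm of the plaquette variable). [folklore] -/
theorem fluxGrad_constFlux [Nonempty n] (hκ : κ₀ ≠ κ₁)
    (hW : ∀ (y : Site d) (κ : Fin d), W y κ = if κ = κ₁ then expUnit (((y κ₀ : ℤ) : ℂ) • B) else 1) (hB : B ∈ skewAdjoint (Matrix n n ℂ))
    {a : ℝ} (ha : ‖exp B - 1‖ ≤ a) (ha' : ‖exp (-B) - 1‖ ≤ a) (ha1 : a < 1) (z : Site d) (μ : Fin d) (π : T4AveragingDeficitWall.Plane d) :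
    ‖covGrad W (flux W) z μ π‖ ≤ 0 := by
  have hsf := smallField_constFlux hκ hW ha ha'
  have hWu := isUnitaryCfg_constFlux hW hB
  have hlt : ‖((fhol W (z, π) : (Matrix n n ℂ)ˣ) : Matrix n n ℂ) - 1‖ < 1 :=
    (hsf z π.1.1 π.1.2 (ne_of_lt π.2)).trans_lt ha1
  have hind : fhol W (z + e μ, π) = fhol W (z, π) := hol_site_indep hκ hW _ _ _ _
  have hcomm : Commute ((W z μ : (Matrix n n ℂ)ˣ) : Matrix n n ℂ) ((fhol W (z, π) : (Matrix n n ℂ)ˣ) : Matrix n n ℂ) :=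
    commute_link_hol hκ hW z μ z π.1.1 π.1.2
  have hlog : mlog ((fhol W (z, π) : (Matrix n n ℂ)ˣ) : Matrix n n ℂ)
      = Ad (W z μ) (mlog ((fhol W (z, π) : (Matrix n n ℂ)ˣ) : Matrix n n ℂ)) := by
    have h := mlog_units_conj (mem_U1_of_unitary (hWu z μ)) hlt
    rw [hcomm.eq, mul_assoc, Units.mul_inv, mul_one] at h
    exact h
  have hzero : covGrad W (flux W) z μ π = 0 := by
    unfold covGrad flux
    rw [hind, ← hlog, sub_self]
  rw [hzero, norm_zero]

/-! ## §4 Criticality on every periodic direction -/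

/-- **THE CONSTANT-FLUX BACKGROUND IS CRITICAL ON EVERY PERIODIC DIRECTION**: `dAction W Y (perWin d P) = 0` for every `P`-periodic `Y` (`P ≥ 1`, `e^{PB} = 1`) — the by-parts
letter F61 with the plaquette field itself as `G`: its covariant adjacent differences vanish (site-independent, commuting with the links). [folklore] -/
theorem dAction_constFlux_eq_zero (hκ : κ₀ ≠ κ₁)
    (hW : ∀ (y : Site d) (κ : Fin d), W y κ = if κ = κ₁ then expUnit (((y κ₀ : ℤ) : ℂ) • B) else 1)
    {P : ℕ} (hP : 1 ≤ P) (hBP : expUnit ((P : ℂ) • B) = 1)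
    {Y : Site d → Fin d → Matrix n n ℂ} (hYP : IsPeriodicDir Y (P : ℤ)) : dAction W Y (perWin d P) = 0 := by
  have hWP := isPeriodicCfg_constFlux hW hBP
  set G : Site d → Fin d → Fin d → Matrix n n ℂ := fun z μ ν => ((hol W z (plaqWord μ ν) : (Matrix n n ℂ)ˣ) : Matrix n n ℂ) with hG
  have hGind : ∀ (z z' : Site d) (μ ν : Fin d), G z μ ν = G z' μ ν := fun z z' μ ν => by
    simp only [hG, hol_site_indep hκ hW z z']
  have hGP : ∀ (z : Site d) (κ μ ν : Fin d), G (z + (P : ℤ) • e κ) μ ν = G z μ ν := fun z κ μ ν => hGind _ _ _ _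
  -- every transport fixes `G`
  have hAd : ∀ (u : (Matrix n n ℂ)ˣ) (z : Site d) (μ ν : Fin d),
      Commute ((u : (Matrix n n ℂ)ˣ) : Matrix n n ℂ) (G z μ ν) → Ad u⁻¹ (G z μ ν) = G z μ ν :=
    fun u z μ ν h => Ad_eq_of_commute (Commute.units_inv_left h)
  have hc : ∀ (y : Site d) (κ : Fin d) (z : Site d) (μ ν : Fin d), Commute ((W y κ : (Matrix n n ℂ)ˣ) : Matrix n n ℂ) (G z μ ν) :=
    fun y κ z μ ν => commute_link_hol hκ hW y κ z μ ν
  have hG₁ : ∀ (π : T4AveragingDeficitWall.Plane d) (z : Site d),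
      ‖Ad (W z π.1.1)⁻¹ (G z π.1.1 π.1.2)
          - Ad (W (z - e π.1.2) π.1.1 * W (z - e π.1.2 + e π.1.1) π.1.2)⁻¹ (G (z - e π.1.2) π.1.1 π.1.2)‖ ≤ 0 := by
    intro π z
    rw [hAd _ _ _ _ (hc _ _ _ _ _), hGind (z - e π.1.2) z,
      hAd _ _ _ _ (by rw [Units.val_mul]; exact (hc _ _ _ _ _).mul_left (hc _ _ _ _ _)), sub_self, norm_zero]
  have hG₂ : ∀ (π : T4AveragingDeficitWall.Plane d) (z : Site d),
      ‖Ad (W (z - e π.1.1) π.1.1 * W z π.1.2)⁻¹ (G (z - e π.1.1) π.1.1 π.1.2)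
          - Ad (W z π.1.1 * W (z + e π.1.1) π.1.2 * (W (z + e π.1.2) π.1.1)⁻¹)⁻¹ (G z π.1.1 π.1.2)‖ ≤ 0 := by
    intro π z
    rw [hGind (z - e π.1.1) z, hAd _ _ _ _ (by rw [Units.val_mul]; exact (hc _ _ _ _ _).mul_left (hc _ _ _ _ _)),
      hAd _ _ _ _ (by
        rw [Units.val_mul, Units.val_mul]
        exact ((hc _ _ _ _ _).mul_left (hc _ _ _ _ _)).mul_left (Commute.units_inv_left (hc _ _ _ _ _))),
      sub_self, norm_zero]
  have h := abs_sum_nReTr_curlAt_mul_le_W hP hWP hYP hGP le_rfl hG₁ hG₂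
  rw [zero_mul, zero_mul] at h
  have h0 : ∑ p ∈ perWin d P, nReTr (curlAt W Y p.1 p.2.1.1 p.2.1.2 * G p.1 p.2.1.1 p.2.1.2) = 0 := abs_nonpos_iff.mp h
  unfold dAction
  rw [neg_eq_zero]
  simpa only [hG, curl, fhol] using h0

/-- In particular the constant-flux background is TANGENT-CRITICAL at every level (F123d's `hcritW`). [folklore] -/
theorem tanCritical_constFlux (hκ : κ₀ ≠ κ₁)
    (hW : ∀ (y : Site d) (κ : Fin d), W y κ = if κ = κ₁ then expUnit (((y κ₀ : ℤ) : ℂ) • B) else 1)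
    {L N j : ℕ} (hP : 1 ≤ N * L ^ (j + 1)) (hBP : expUnit (((N * L ^ (j + 1) : ℕ) : ℂ) • B) = 1) :
    ∀ Y : Site d → Fin d → Matrix n n ℂ, IsSkewDir Y → IsPeriodicDir Y ((N * L ^ (j + 1) : ℕ) : ℤ) → dirIter L (j + 1) W Y = 0 →
      dAction W Y (perWin d (N * L ^ (j + 1))) = 0 :=
  fun _ _ hYP _ => dAction_constFlux_eq_zero hκ hW hP hBP hYP

/-! ## §5 The slice-solver letter fails at the constant-flux background -/

/-- **F123d's (L2) LETTER IS UNSATISFIABLE AT THE CONSTANT-FLUX BACKGROUND**: `d`, `L ≥ 2`, `N ≥ 1`, `j`; `κ₀ ≠ κ₁`; skew `B` with `e^{(N·L^{j+1})B} = 1`; the background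
`W(y,κ₁) = e^{y_{κ₀}B}`, `W = 1` elsewhere, of small-field radius `a ≥ ‖e^{±B} − 1‖` with `LevelSmall d L j a`; ONE skew `ζ` with `ζ − Ad_{e^{B}}ζ ≠ 0`.  Then no `S ⊇ {W-tangent skew
periodic fields}` and no `K_G` satisfy F123d's `hG` — although `W` satisfies every background hypothesis of F123d (§3–§4).  Witness: the tangent gauge mode of the periodised bump at
`e_{κ₀}` with value `ζ` (F128). [folklore] -/
theorem sliceLetter_false_constFlux [Nonempty n] {L N : ℕ} [NeZero N] (hL : 2 ≤ L) (j : ℕ) (hκ : κ₀ ≠ κ₁)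
    (hW : ∀ (y : Site d) (κ : Fin d), W y κ = if κ = κ₁ then expUnit (((y κ₀ : ℤ) : ℂ) • B) else 1) (hB : B ∈ skewAdjoint (Matrix n n ℂ))
    (hBP : expUnit (((N * L ^ (j + 1) : ℕ) : ℂ) • B) = 1)
    {a : ℝ} (ha : ‖exp B - 1‖ ≤ a) (ha' : ‖exp (-B) - 1‖ ≤ a) (hs : LevelSmall d L j a)
    {ζ : Matrix n n ℂ} (hζ : ζ ∈ skewAdjoint (Matrix n n ℂ)) (hne : ζ - Ad (expUnit B) ζ ≠ 0)
    (S : Set (Site d → Fin d → Matrix n n ℂ))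
    (hS : ∀ X : Site d → Fin d → Matrix n n ℂ, IsSkewDir X → IsPeriodicDir X ((N * L ^ (j + 1) : ℕ) : ℤ) → dirIter L (j + 1) W X = 0 → X ∈ S)
    {KG : ℝ}
    (hG : ∀ X ∈ S, IsPeriodicDir X ((N * L ^ (j + 1) : ℕ) : ℤ) → dirIter L (j + 1) W X = 0 → ∀ g : ℝ, 0 ≤ g →
      (∀ Y : Site d → Fin d → Matrix n n ℂ, IsSkewDir Y → IsPeriodicDir Y ((N * L ^ (j + 1) : ℕ) : ℤ) → dirIter L (j + 1) W Y = 0 →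
        |hess W X Y (perWin d (N * L ^ (j + 1)))| ≤ g * dirL1 Y (periodBox (d := d) (N * L ^ (j + 1)))) →
      ∀ z μ' ν', μ' ≠ ν' → ‖curlAt W X z μ' ν'‖ ≤ KG * g) : False := by
  classical
  -- the period
  have hN : 1 ≤ N := Nat.pos_of_ne_zero (NeZero.ne N)
  have hM2 : 2 ≤ L ^ (j + 1) := le_trans hL (Nat.le_self_pow (Nat.succ_ne_zero j) L)
  have hP2 : 2 ≤ N * L ^ (j + 1) := le_trans hM2 (Nat.le_mul_of_pos_left _ hN)
  have hP1 : 1 ≤ N * L ^ (j + 1) := le_trans (by norm_num) hP2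
  -- class data of `W`
  have hWu := isUnitaryCfg_constFlux hW hB
  have hWP := isPeriodicCfg_constFlux hW hBP
  have hWx := smallField_constFlux hκ hW ha ha'
  have ha0 : 0 ≤ a := (norm_nonneg _).trans ha
  have hcrit : ∀ Y : Site d → Fin d → Matrix n n ℂ, IsSkewDir Y → IsPeriodicDir Y ((N * L ^ (j + 1) : ℕ) : ℤ) →
      dAction W Y (perWin d (N * L ^ (j + 1))) = 0 := fun Y _ hYP => dAction_constFlux_eq_zero hκ hW hP1 hBP hYP
  -- the bump at `e κ₀` with value `ζ`
  set ξ : Site d → Matrix n n ℂ := fun y => if (∀ i : Fin d, ((N * L ^ (j + 1) : ℕ) : ℤ) ∣ y i - (e κ₀ : Site d) i) then ζ else 0 with hξdef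
  have hξ : ∀ y : Site d, ξ y = if (∀ i : Fin d, ((N * L ^ (j + 1) : ℕ) : ℤ) ∣ y i - (e κ₀ : Site d) i) then ζ else 0 := fun y => rfl
  have hξs := bump_skew hξ hζ
  have hξP := bump_periodic hξ
  have hξsp := bump_sparse hξ hP2
  have hMP : ((L : ℤ) ^ (j + 1)) ∣ (((N * L ^ (j + 1) : ℕ) : ℤ)) := ⟨(N : ℤ), by push_cast; ring⟩
  have hx₀ : ¬ ((L : ℤ) ^ (j + 1)) ∣ (e κ₀ : Site d) κ₀ := by
    simp only [B7Prop1Explicit.e, Pi.single_eq_same]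
    intro h
    have h1 : ((L : ℤ) ^ (j + 1)) ≤ 1 := Int.le_of_dvd one_pos h
    have h2 : (2 : ℤ) ≤ (L : ℤ) ^ (j + 1) := by exact_mod_cast hM2
    omega
  have hξc := bump_vanish_corners hξ hMP hx₀
  -- the plaquette at `e κ₀` in the plane `(κ₀, κ₁)` is `e^{B}`
  have hhol : hol W (e κ₀) (plaqWord κ₀ κ₁) = expUnit B := by
    rw [hol_plaqWord_eq hκ hW, if_pos ⟨rfl, rfl⟩]
  have hne' : ξ (e κ₀) - Ad (hol W (e κ₀) (plaqWord κ₀ κ₁)) (ξ (e κ₀)) ≠ 0 := by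
    rw [bump_centre hξ, hhol]
    exact hne
  exact sliceLetter_false_of_critical (by omega) j hWu hWP ha0 hs hWx hcrit hξs hξP hξsp hξc hκ hne' S hS hG

end Flux

end

end Summit.QuantumFields.BalabanUV.T4Continuum.NE7ConstantFluxBackground
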